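import Summits.BirchSwinnertonDyer.BirchSwinnertonDyer.Theses.VerticalHeegnerOrder
import Literature.NumberTheory.EllipticCurves.HeegnerModuleIndex
import Literature.NumberTheory.EllipticCurves.BSDSelmerParityDokchitserBaseChangeProofs
import Literature.NumberTheory.EllipticCurves.ZpExtensionAnticyclotomicHoldsProofs
import Literature.NumberTheory.EllipticCurves.BSDSelmerParityDokchitserTowerProofs

/-!
# Line `birth` (BC3 skeleton) for crux `VerticalHeegnerOrder.VerticalKolyvaginBound`
# (stmt-BirchSwinnertonDyer-18467, route `route-BirchSwinnertonDyer-VerticalHeegnerOrder`, crux rank 3)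

Registered by the skeleton registrar `planner-skel-stmt-BirchSwinnertonDyer-18467-0` (2026-08-17),
re-audit bin HONEST. It REPLACES the earlier two-stub sketch attached to the item as evidence only
(`VerticalKolyvaginBound_birth.lean`: `stub_first_derivative` = the crux at `j = 1`,
`stub_higher_derivative` = the crux for `2 ≤ j`) — a case split of the crux by the range of `j`, each half
the crux restated on a sub-range, i.e. not a decomposition of the MATHEMATICS. The present line cuts
along the route's own two-layer plan "X2 ⇐ Thm B (finite-layer criterion) → Thm A0 (Howard's bound)",
typed over the tree's Λ-adic objects of `Literature/NumberTheory/EllipticCurves/HeegnerModuleIndex.lean`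
(`LambdaAdicSelmerData`, `HeegnerFamily`, `heegnerModuleIndex : ℕ∞`, `HowardHypotheses`,
`Howard2004_selmerCorank_le`).

## The crux (recall)

`VerticalKolyvaginBound` (X2 of the route): for `W/ℚ` global minimal elliptic with `2 ≤ r_an(W)`, `K`
imaginary quadratic (embedding `ι`), Heegner for `N = N_W`, `d_K < −4`, an ADMISSIBLE prime `p`
(`p ≥ 5` good ordinary, `ρ̄_{W,p}` surjective, `p ∤ d_K`, `p ∤ h_K`), `1 ≤ j ≤ p − 1`, a modular
parametrisation `Dt` of level `N`, an orientation `β` (`β² ≡ d_K mod 4N`), the Heegner point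
`y ∈ E(K[p²])` of conductor `p²` (pinned through `heegnerPointComplexOfConductor`), an index-`p` normal
subgroup `H ≤ Gal(K[p²]/K)` (so `K[p²]^H = K₁`, the first anticyclotomic layer, as `p ∤ h_K`, `d_K < −4`)
and `σ ∈ Gal(K[p²]/K) ∖ H`: IF the divided-derivative test passes — `Σ_{i<p} C(i,j) σ^i P₁`,
`P₁ := Σ_{τ ∈ H} τ y`, is NOT `p·Q + T` with `Q` `H`-invariant and `T` torsion — THEN
`s_p(W) + s_p(W^K) ≤ 2j + 1` (`s_p` = `ℤ_p`-corank of `Sel_{p^∞}` over `ℚ`, `W^K` the `d_K`-twist).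

## The cut: tower infrastructure ⟂ finite-layer criterion ⟂ Galois image ⟂ Howard's Λ-adic bound

Four named stubs from four different bodies of mathematics; none mentions the conclusion of the crux
together with its test, and the composition `VerticalKolyvaginBound_of` is sorry-free:

* **T · `stub_towerData`** (INFRASTRUCTURE — CM theory + compact Iwasawa cohomology; size L): for `K`
  imaginary quadratic Heegner for `N_W`, `p` of good reduction (so `p ∤ N_W`), an orientation `β`, any
  `ℤ_p`-extension `κ` with topological generator `γ` and any `jbar : K̄ → ℂ`, there exist a Λ-adic Selmer
  datum `D` (`𝔖_p(K_∞) = lim← S_p(E/K_n)`, Perrin-Riou 1987 §0; Howard 2004 Def. 3.2.3) and a Heegner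
  family `F` along `κ` WITH `F.Dt = Dt`, `F.β = β` (Heegner points of conductor `p^{n+1}` rational over
  `K[p^{n+1}]`, normed to `K_n`: Howard 2004 §2.7, §3.3; Perrin-Riou 1987 §3). In the tree these are
  exactly instances of the two undischarged named facts `WeierstrassCurve.lambdaAdicSelmerData_exists_unique`
  (first conjunct) and `exists_isHeegnerNormPoint` (assembled as in `nonempty_heegnerFamily_of`, which
  keeps `Dt` and `β`), plus `not_dvd_conductorNorm_of_hasGoodReductionAtPrime`.
* **A · `stub_finiteLayerCriterion`** (THE HEART — the 2001 programme's Thm B "finite-layer criterion";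
  size XL, and the only stub with research content): under ALL the hypotheses of the crux (verbatim,
  including `2 ≤ r_an(W)`, admissibility, `1 ≤ j ≤ p − 1` and the passed test), for every anticyclotomic
  `κ` with topological generator `γ`, every `jbar` above `ι`, every Λ-adic Selmer datum `D` and every
  Heegner family `F` with `F.Dt = Dt`, `F.β = β`: the Heegner module index is at most `j`,
  `heegnerModuleIndex D F ≤ j` (`= ord_J char(𝔖_∞/ℋ_∞)`, `J` the augmentation ideal). Mechanism (2001
  §4; nothing of it is in print): `𝔖_∞` is free of rank one (Howard Thm B (torsion-free rank one) +
  Perrin-Riou Lemme 5 reflexivity), `ℋ_∞ = Λ κ_∞` free of rank one (Cornut + Perrin-Riou Prop. 10), so the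
  index is `a = ord_T g` with `κ_∞ = g · s_∞`; if `a ≥ j + 1` then projecting to `K₁` puts the level-one
  Heegner class `z₁ ∈ (σ − 1)^{j+1} S_p(E/K₁)`; Lemma 4.1: `(σ − 1)^{j+1} D^{(j)} ∈ p (σ − 1) ℤ[Gal(K₁/K)]`
  for `j ≤ p − 1` (this is where `j + 1 ≤ p` is essential: `v_p C(p, i)`); `z₁ = δ(P₁) + (unit)·δ(y_K)`-type
  comparison with `y_K` torsion because `r_an(W) ≥ 2` kills `L'(E/K, 1)` (Gross–Zagier) and `E(K₁)[p] = 0`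
  (from `ρ̄` surjective); `T_p Ш` torsion-free then forces `D^{(j)} P₁ ∈ p E(K₁) + E(K₁)_tors`, i.e. the
  test FAILS. `p ∤ h_K`, `d_K < −4` make `K[p²]^H = K₁` and `P₁` Howard's level-one generator; the test is
  invariant under `P₁ ↦ σ^i P₁` and under the choice of `σ ∉ H`.
* **B1 · `stub_howardHypotheses`** (GALOIS IMAGE — Serre's lemma; size M): the crux's admissibility
  package discharges Howard's standing hypotheses `HowardHypotheses N_W W K p κ γ` for anticyclotomic `κ`
  with generator `γ`: `d_K < −4 ⇒ d_K ≠ −3, −4`; `5 ≤ p ⇒ p ≠ 2`; good reduction ⇒ `p ∤ N_W`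
  (`not_dvd_conductorNorm_of_hasGoodReductionAtPrime`); good + `p ∤ a_p` = `IsOrdinaryAt`; and the one real
  step, `Γ_K ↠ Aut_{ℤ_p}(T_p E)`: `ρ̄_{E,p}(Γ_ℚ) = GL₂(𝔽_p)` with `p ≥ 5` ⇒ `ρ_{E,p^∞}(Γ_ℚ) = GL₂(ℤ_p)`
  (Serre's lemma, Lang *Elliptic Functions* Ch. 17 §4 Lemma; Serre *Abelian ℓ-adic reps* IV-23 Lemma 3),
  and `ρ(Γ_K)` has index `≤ 2`; the unique index-2 subgroup of `GL₂(ℤ_p)` (`SL₂(ℤ_p)` perfect for `p ≥ 5`,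
  `GL₂(ℤ_p)^{ab} = ℤ_p^×`, unique quadratic character the Legendre symbol of `det`) cuts out `ℚ(√p*)`,
  excluded by `p ∤ d_K`.
* **B2 · `stub_howardBound`** (HOWARD 2004, Compositio 140, §1 eq. (2) with Thm B(c) + Mazur control;
  KNOWN IN PRINT, size XL to formalise): literally the tree's named fact
  `Howard2004_selmerCorank_le N_W W K p κ γ jbar` — under `HowardHypotheses`, for every `D`, `F`:
  `corank_{ℤ_p} Sel_{p^∞}(E/K) ≤ 1 + 2 · heegnerModuleIndex D F` in `ℕ∞`.

`VerticalKolyvaginBound_of` (sorry-free): take the anticyclotomic `κ` (tree THEOREM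
`ZpExtension.exists_isAnticyclotomic_holds`), a topological generator `γ` (`ZpExtension.exists_isTopGenerator`),
`jbar` above `ι` (`IsAlgClosed.lift`), `D, F` from T, `index ≤ j` from A, Howard's hypotheses from B1, the
bound `s_p(E/K) ≤ 1 + 2j` from B2, and descend to `ℚ` by the PROVED quadratic base change of coranks
`s_p(E/K) = s_p(W) + s_p(W^{d_K})` (`selmerCorank_baseChange_quadratic_holds`, Dokchitser–Dokchitser 2010
Lem. 4.14 in the tree).

Honest sizes: T known (L, CM + Iwasawa cohomology infrastructure); B1 known (M); B2 known in print (XL);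
A = the research content of the crux (the 2001 internal Thm B; no printed source). Load-bearing stub: A.

Disproof used: no `Disproof.lean` exists for this crux (`ledger crux ls stmt-BirchSwinnertonDyer-18467`:
no workfiles before this line), so there is no `_false_without_` obstruction to honour and no landed
Negative lemma to import. Negatives index of the summit (1 entry, stmt-BirchSwinnertonDyer-15532,
LeadingTerm `TamePinch`: CM curves lack an admissible `p`): not an instance of any stub — every stub takes
a GIVEN admissible `p`, never its existence (existence of admissible data is the route's OTHER cruxes X1/X3).

BC3 probes (planner folder `bc/probe.lean`, 2026-08-17): for each stub `S ∈ {T, A, B1, B2}`, both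
`S → VerticalKolyvaginBound` and `S → BirchSwinnertonDyer` by `first | exact? | simpa | aesop` FAIL (see
the line card `Lines/birth.md` for the verbatim outcomes).
-/

set_option linter.unusedVariables false
set_option linter.dupNamespace false

noncomputable section

namespace Summit.BirchSwinnertonDyer.BirchSwinnertonDyer.Cruxes.VerticalKolyvaginBound.Birth

open scoped BigOperators Classical
open Summit.BirchSwinnertonDyer.BirchSwinnertonDyer.Theses.VerticalHeegnerOrder
open Literature
open Literature.NumberTheory.EllipticCurves
open Literature.NumberTheory.EllipticCurves.ModularForms

/-! ## The crux's matrix, cut verbatim into named pieces -/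

/-- `Admissible W K p`: the crux's admissibility package for the prime `p` (verbatim): `5 ≤ p`, good
reduction at `p`, `p ∤ a_p(W)` (ordinary), `ρ̄_{W,p}` surjective, `p ∤ d_K`, `p ∤ h_K`. -/
def Admissible (W : WeierstrassCurve ℚ) [W.IsGloballyMinimal] (K : Type) [Field K] [NumberField K]
    (p : ℕ) [Fact p.Prime] : Prop :=
  5 ≤ p ∧ W.HasGoodReductionAtPrime p ∧ ¬ (p : ℤ) ∣ W.frobeniusTrace p ∧ W.HasSurjectiveModNGaloisRep p ∧
    ¬ (p : ℤ) ∣ NumberField.discr K ∧ ¬ p ∣ NumberField.classNumber K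

/-- `TestPasses W K ι p j y H σ`: the crux's divided-derivative test at level `p²` (verbatim the
negated existential): `Σ_{i<p} C(i,j) σ^i (Σ_{τ∈H} τ y)` is NOT `p • Q + T` with `Q` `H`-invariant and
`T` of finite order in `E(K[p²])`. -/
def TestPasses (W : WeierstrassCurve ℚ) (K : Type) [Field K] [NumberField K] (ι : K →+* ℂ) (p j : ℕ)
    (y : (W.baseChange (ringClassField K ι (p ^ 2))).toAffine.Point)
    (H : Subgroup (ringClassField K ι (p ^ 2) ≃ₐ[ℚ] ringClassField K ι (p ^ 2)))
    (σ : ringClassField K ι (p ^ 2) ≃ₐ[ℚ] ringClassField K ι (p ^ 2)) : Prop :=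
  ¬ ∃ (Q T : (W.baseChange (ringClassField K ι (p ^ 2))).toAffine.Point), IsOfFinAddOrder T ∧
    (∀ τ ∈ H, pointGalHom W (ringClassField K ι (p ^ 2)) τ Q = Q) ∧
    (∑ i ∈ Finset.range p, Nat.choose i j •
      pointGalHom W (ringClassField K ι (p ^ 2)) (σ ^ i)
        (∑ᶠ τ ∈ (H : Set (ringClassField K ι (p ^ 2) ≃ₐ[ℚ] ringClassField K ι (p ^ 2))),
          pointGalHom W (ringClassField K ι (p ^ 2)) τ y)) = p • Q + T

/-- Sanity (definitional): the crux is, on the nose, "hypotheses → `Admissible` → … → `TestPasses` →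
`s_p(W) + s_p(W^K) ≤ 2j + 1`". -/
theorem verticalKolyvaginBound_iff :
    VerticalKolyvaginBound ↔
      ∀ (W : WeierstrassCurve ℚ) [W.IsElliptic] [W.IsGloballyMinimal] [NeZero (W.conductorNorm ℤ)]
        (K : Type) [Field K] [NumberField K] (ι : K →+* ℂ) (p : ℕ) [Fact p.Prime] (j : ℕ)
        (Dt : ModularParametrizationData W (W.conductorNorm ℤ)) (β : ℤ)
        (y : (W.baseChange (ringClassField K ι (p ^ 2))).toAffine.Point)
        (H : Subgroup (ringClassField K ι (p ^ 2) ≃ₐ[ℚ] ringClassField K ι (p ^ 2)))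
        (σ : ringClassField K ι (p ^ 2) ≃ₐ[ℚ] ringClassField K ι (p ^ 2)),
        IsImaginaryQuadratic K → SatisfiesHeegnerHypothesis (W.conductorNorm ℤ) K →
        NumberField.discr K < -4 → 2 ≤ W.analyticRank → Admissible W K p → 1 ≤ j → j + 1 ≤ p →
        (4 * (W.conductorNorm ℤ : ℤ)) ∣ β ^ 2 - NumberField.discr K →
        WeierstrassCurve.Affine.Point.map (ringClassField K ι (p ^ 2)).subtype.toRatAlgHom y =
          heegnerPointComplexOfConductor Dt (NumberField.discr K) β (p ^ 2) →
        H ≤ ringClassGal ι (p ^ 2) → H.relIndex (ringClassGal ι (p ^ 2)) = p →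
        (∀ g ∈ ringClassGal ι (p ^ 2), ∀ h ∈ H, g * h * g⁻¹ ∈ H) →
        σ ∈ ringClassGal ι (p ^ 2) → σ ∉ H → TestPasses W K ι p j y H σ →
        W.selmerCorank p + (W.quadraticTwist (NumberField.discr K : ℚ)).selmerCorank p ≤ 2 * j + 1 :=
  Iff.rfl

/-! ## Registered stubs -/

/-- **T · `stub_towerData` — the tower objects exist (INFRASTRUCTURE: CM theory + compact Iwasawa
cohomology).** For `W/ℚ` elliptic (global minimal, `N = N_W`), `K` imaginary quadratic Heegner for `N`,
`p` of good reduction (hence `p ∤ N`), an orientation `β`, a `ℤ_p`-extension `κ` with topological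
generator `γ` and an embedding `jbar : K̄ → ℂ`: there are a Λ-adic Selmer datum
`D : 𝔖_p(K_∞) = lim← S_p(E/K_n)` and a Heegner family `F` along `κ` (basic point `y_K`, norm points
`z_n = Norm_{K[p^{n+1}]/K_n} P[p^{n+1}]`) with `F.Dt = Dt`, `F.β = β`. Instances of the tree's named facts
`WeierstrassCurve.lambdaAdicSelmerData_exists_unique` (∃-half) and `exists_isHeegnerNormPoint`
(assembled as in `nonempty_heegnerFamily_of`). [cite: PerrinRiou1987BSMF, §0 p. 402 and §3.1–3.4]
[cite: Howard2004HeegnerKolyvagin, Def. 3.2.3, §2.7, §3.3] [cite: GrossLMS1991, §3] -/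
theorem stub_towerData :
    ∀ (W : WeierstrassCurve ℚ) [W.IsElliptic] [W.IsGloballyMinimal] [NeZero (W.conductorNorm ℤ)]
      (K : Type) [Field K] [NumberField K] (p : ℕ) [Fact p.Prime]
      (Dt : ModularParametrizationData W (W.conductorNorm ℤ)) (β : ℤ)
      (κ : ZpExtension K p) (γ : Field.absoluteGaloisGroup K) (jbar : AlgebraicClosure K →+* ℂ),
      IsImaginaryQuadratic K → SatisfiesHeegnerHypothesis (W.conductorNorm ℤ) K →
      W.HasGoodReductionAtPrime p → (4 * (W.conductorNorm ℤ : ℤ)) ∣ β ^ 2 - NumberField.discr K →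
      κ.IsTopGenerator γ →
      ∃ (D : (W.baseChange K).LambdaAdicSelmerData κ γ) (F : HeegnerFamily (W.conductorNorm ℤ) W K κ jbar),
        F.Dt = Dt ∧ F.β = β := by
  sorry

/-- **A · `stub_finiteLayerCriterion` — the finite-layer criterion (2001 programme, Thm B; THE HEART).**
Under all hypotheses of the crux (verbatim: `2 ≤ r_an(W)`, `K` Heegner with `d_K < −4`, `p` admissible,
`1 ≤ j ≤ p − 1`, the Heegner datum `(Dt, β, y, H, σ)` at level `p²`, and the PASSED divided-derivative
test), for every anticyclotomic `κ` with topological generator `γ`, every `jbar` above `ι`, every Λ-adic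
Selmer datum `D` and every Heegner family `F` with `F.Dt = Dt`, `F.β = β`:
`heegnerModuleIndex D F ≤ j` (`ord_J char(𝔖_∞/ℋ_∞) ≤ j`). Why plausibly true: `𝔖_∞ ≅ Λ` and
`ℋ_∞ = Λ κ_∞` free of rank one (Howard Thm B + Perrin-Riou Lemme 5 / Prop. 10 + Cornut), index
`= ord_T g`; `ord_T g ≥ j + 1` ⇒ (project to `K₁`) `z₁ ∈ (σ−1)^{j+1} S_p(E/K₁)`; Lemma 4.1
`(σ−1)^{j+1} D^{(j)} ∈ p(σ−1)ℤ[G]` for `j ≤ p − 1`; `y_K` torsion (`r_an ≥ 2`, Gross–Zagier),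
`E(K₁)[p] = 0` (`ρ̄` surjective), `T_p Ш` torsion-free ⇒ `D^{(j)}P₁ ∈ pE(K₁) + tors`, contradicting the
test. Why it might fail: only through a normalisation mismatch between the crux's finite-level test
(`H`-trace of `y_{p²}`, binomial divided derivative in `σ`) and Howard's generator `Norm_{K[p²]/K₁}P[p²]`
(they agree when `K[p²]^H = K₁`, which needs `p ∤ h_K`, `d_K < −4`, `p ∤ d_K` — all in `Admissible`).
No printed source (2001 internal Thm B / Lemma 4.1 / Lemma Z); nearest in print: Howard 2004 §1 eq. (2)
and Thm B; CHKLL 2023 (derived heights ↔ `ord_J`); Kolyvagin 1991 (horizontal structure theorem).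
[cite: Howard2004HeegnerKolyvagin, §1 eq. (2), Thm. B, §3.3] [cite: PerrinRiou1987BSMF, §2.2 Lemme 5, §3.4 Prop. 10]
[cite: GrossZagier1986, Thm. I.6.3] (CHKLL arXiv:2308.10474 Thm 3.2; Kolyvagin 1991 doi:10.1007/bf01445205.) -/
theorem stub_finiteLayerCriterion :
    ∀ (W : WeierstrassCurve ℚ) [W.IsElliptic] [W.IsGloballyMinimal] [NeZero (W.conductorNorm ℤ)]
      (K : Type) [Field K] [NumberField K] (ι : K →+* ℂ) (p : ℕ) [Fact p.Prime] (j : ℕ)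
      (Dt : ModularParametrizationData W (W.conductorNorm ℤ)) (β : ℤ)
      (y : (W.baseChange (ringClassField K ι (p ^ 2))).toAffine.Point)
      (H : Subgroup (ringClassField K ι (p ^ 2) ≃ₐ[ℚ] ringClassField K ι (p ^ 2)))
      (σ : ringClassField K ι (p ^ 2) ≃ₐ[ℚ] ringClassField K ι (p ^ 2)),
      IsImaginaryQuadratic K → SatisfiesHeegnerHypothesis (W.conductorNorm ℤ) K →
      NumberField.discr K < -4 → 2 ≤ W.analyticRank → Admissible W K p → 1 ≤ j → j + 1 ≤ p →
      (4 * (W.conductorNorm ℤ : ℤ)) ∣ β ^ 2 - NumberField.discr K →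
      WeierstrassCurve.Affine.Point.map (ringClassField K ι (p ^ 2)).subtype.toRatAlgHom y =
        heegnerPointComplexOfConductor Dt (NumberField.discr K) β (p ^ 2) →
      H ≤ ringClassGal ι (p ^ 2) → H.relIndex (ringClassGal ι (p ^ 2)) = p →
      (∀ g ∈ ringClassGal ι (p ^ 2), ∀ h ∈ H, g * h * g⁻¹ ∈ H) →
      σ ∈ ringClassGal ι (p ^ 2) → σ ∉ H → TestPasses W K ι p j y H σ →
      ∀ (κ : ZpExtension K p) (γ : Field.absoluteGaloisGroup K) (jbar : AlgebraicClosure K →+* ℂ)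
        (D : (W.baseChange K).LambdaAdicSelmerData κ γ) (F : HeegnerFamily (W.conductorNorm ℤ) W K κ jbar),
        κ.IsAnticyclotomic → κ.IsTopGenerator γ →
        jbar.comp (algebraMap K (AlgebraicClosure K)) = ι → F.Dt = Dt → F.β = β →
        heegnerModuleIndex D F ≤ (j : ℕ∞) := by
  sorry

/-- **B1 · `stub_howardHypotheses` — the admissibility package discharges Howard's standing hypotheses
(GALOIS IMAGE: Serre's lemma).** For `W/ℚ` elliptic global minimal, `K` imaginary quadratic Heegner for
`N_W` with `d_K < −4`, `p` admissible, `κ` anticyclotomic with topological generator `γ`: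
`HowardHypotheses N_W W K p κ γ`. Field by field: `d_K ≠ −3, −4` (from `d_K < −4`); `p ≠ 2` (`5 ≤ p`);
`p ∤ N_W` (good reduction, `not_dvd_conductorNorm_of_hasGoodReductionAtPrime`); `p ∤ d_K`, `p ∤ h_K`
(given); ordinary = good + `p ∤ a_p` (`isOrdinaryAt_iff`); and `Γ_K ↠ Aut_{ℤ_p}(T_p E)`: mod-`p`
surjectivity over `ℚ` with `p ≥ 5` gives `ρ_{E,p^∞}(Γ_ℚ) = GL₂(ℤ_p)` (Serre's lemma), and the unique
index-2 subgroup of `GL₂(ℤ_p)` cuts out `ℚ(√p*) ≠ K` since `p ∤ d_K`. Why it might fail: only if the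
tree's `galoisRepTate`-surjectivity (every `ℤ_p`-linear automorphism of `T_p E` is Galois) is not what
Serre's lemma delivers for the tree's `tateModule` (e.g. a non-free `T_p` for singular `W` — excluded by
`[W.IsElliptic]`). [cite: Serre1972, §4] [cite: Howard2004HeegnerKolyvagin, §1 Thm. A/B hypotheses]
(Serre's lemma: Lang, *Elliptic Functions*, Ch. 17 §4 Lemma; Serre, *Abelian ℓ-adic representations*,
IV-23 Lemma 3.) -/
theorem stub_howardHypotheses :
    ∀ (W : WeierstrassCurve ℚ) [W.IsElliptic] [W.IsGloballyMinimal] [NeZero (W.conductorNorm ℤ)]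
      (K : Type) [Field K] [NumberField K] (p : ℕ) [Fact p.Prime]
      (κ : ZpExtension K p) (γ : Field.absoluteGaloisGroup K),
      IsImaginaryQuadratic K → SatisfiesHeegnerHypothesis (W.conductorNorm ℤ) K →
      NumberField.discr K < -4 → Admissible W K p → κ.IsAnticyclotomic → κ.IsTopGenerator γ →
      HowardHypotheses (W.conductorNorm ℤ) W K p κ γ := by
  sorry

/-- **B2 · `stub_howardBound` — Howard 2004, §1 eq. (2): `corank_{ℤ_p} Sel_{p^∞}(E/K) ≤ 1 + 2·ord_J(𝐋)`
(KNOWN IN PRINT: Thm B(c) + Mazur's control theorem).** Literally the tree's named fact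
`Howard2004_selmerCorank_le` at level `N = N_W`: under `HowardHypotheses`, for every Λ-adic Selmer datum
`D` and Heegner family `F`, `s_p(E/K) ≤ 1 + 2 · heegnerModuleIndex D F` in `ℕ∞`. Why it might fail: only
through the tree's typing of `ord_J(𝐋)` as `Module.lengthAt` of `𝔖_∞/ℋ_∞` at `(T)` versus Howard's
`ch(H¹_{F_Λ}(K,𝐓)/𝐇)` (the same ideal for the torsion quotient of a rank-one module; `⊤` makes it
vacuous). [cite: Howard2004HeegnerKolyvagin, §1 eq. (2), Thm. B(c), Thm. 3.2.10] -/
theorem stub_howardBound :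
    ∀ (W : WeierstrassCurve ℚ) [W.IsGloballyMinimal] [NeZero (W.conductorNorm ℤ)]
      (K : Type) [Field K] [NumberField K] (p : ℕ) [Fact p.Prime]
      (κ : ZpExtension K p) (γ : Field.absoluteGaloisGroup K) (jbar : AlgebraicClosure K →+* ℂ),
      Howard2004_selmerCorank_le (W.conductorNorm ℤ) W K p κ γ jbar := by
  sorry

/-! ## Stub statements by name -/

namespace Statement

/-- Statement of `stub_towerData`. -/
abbrev stub_towerData : Prop := type_of% @Birth.stub_towerData
/-- Statement of `stub_finiteLayerCriterion`. -/
abbrev stub_finiteLayerCriterion : Prop := type_of% @Birth.stub_finiteLayerCriterion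
/-- Statement of `stub_howardHypotheses`. -/
abbrev stub_howardHypotheses : Prop := type_of% @Birth.stub_howardHypotheses
/-- Statement of `stub_howardBound`. -/
abbrev stub_howardBound : Prop := type_of% @Birth.stub_howardBound

end Statement

/-! ## The composition (sorry-free) -/

/-- Every embedding `ι : K → ℂ` extends to `K̄ → ℂ` (`ℂ` algebraically closed; Mathlib
`IsAlgClosed.lift`). -/
theorem exists_jbar_comp_eq (K : Type) [Field K] [NumberField K] (ι : K →+* ℂ) :
    ∃ jbar : AlgebraicClosure K →+* ℂ, jbar.comp (algebraMap K (AlgebraicClosure K)) = ι := by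
  letI : Algebra K ℂ := ι.toAlgebra
  exact ⟨(IsAlgClosed.lift (R := K) (S := AlgebraicClosure K) (M := ℂ) : AlgebraicClosure K →ₐ[K] ℂ),
    AlgHom.comp_algebraMap _⟩

/-- The `ℕ∞` arithmetic of the last step: `s ≤ 1 + 2a` and `a ≤ j` give `s ≤ 2j + 1` in `ℕ`. -/
theorem nat_le_of_enat_bound {s j : ℕ} {a : ℕ∞} (hs : ((s : ℕ) : ℕ∞) ≤ 1 + 2 * a) (ha : a ≤ (j : ℕ∞)) :
    s ≤ 2 * j + 1 := by
  have h1 : ((s : ℕ) : ℕ∞) ≤ ((2 * j + 1 : ℕ) : ℕ∞) := by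
    calc ((s : ℕ) : ℕ∞) ≤ 1 + 2 * a := hs
      _ ≤ 1 + 2 * (j : ℕ∞) := by gcongr
      _ = ((2 * j + 1 : ℕ) : ℕ∞) := by push_cast; ring
  exact_mod_cast h1

/-- **`VerticalKolyvaginBound_of`** — the four stub STATEMENTS imply the crux, BY NAME. Logic over the
verbatim cut plus three PROVED tree theorems: the anticyclotomic `ℤ_p`-extension exists
(`ZpExtension.exists_isAnticyclotomic_holds`), it has a topological generator
(`ZpExtension.exists_isTopGenerator`), and the quadratic base change of Selmer coranks
`s_p(E/K) = s_p(W) + s_p(W^{d_K})` (`selmerCorank_baseChange_quadratic_holds`). -/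
theorem VerticalKolyvaginBound_of (hT : Statement.stub_towerData)
    (hA : Statement.stub_finiteLayerCriterion) (hB1 : Statement.stub_howardHypotheses)
    (hB2 : Statement.stub_howardBound) : VerticalKolyvaginBound := by
  intro W _ _ _ K _ _ ι p _ j Dt β y H σ hK hHeeg hdisc hrank hadm hj1 hjp hβ hy hHle hHidx hHnorm hσ hσH
    htest
  -- the anticyclotomic `ℤ_p`-extension of `K` and a topological generator (tree theorems)
  obtain ⟨κ, hκ⟩ : ∃ κ : ZpExtension K p, κ.IsAnticyclotomic := by
    haveI := hK.2
    exact ZpExtension.exists_isAnticyclotomic_holds (K := K) (p := p) hK.1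
      (fun w => NumberField.IsTotallyComplex.isComplex w)
  obtain ⟨γ, hγ⟩ := κ.exists_isTopGenerator
  -- an embedding `K̄ → ℂ` above `ι`
  obtain ⟨jbar, hjbar⟩ := exists_jbar_comp_eq K ι
  -- T: the tower objects
  obtain ⟨D, F, hFDt, hFβ⟩ := hT W K p Dt β κ γ jbar hK hHeeg hadm.2.1 hβ hγ
  -- A: the passed test bounds the Heegner module index
  have hidx : heegnerModuleIndex D F ≤ (j : ℕ∞) :=
    hA W K ι p j Dt β y H σ hK hHeeg hdisc hrank hadm hj1 hjp hβ hy hHle hHidx hHnorm hσ hσH htest κ γ jbar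
      D F hκ hγ hjbar hFDt hFβ
  -- B1: Howard's standing hypotheses hold
  have hH : HowardHypotheses (W.conductorNorm ℤ) W K p κ γ := hB1 W K p κ γ hK hHeeg hdisc hadm hκ hγ
  -- B2: Howard's bound over `K`
  have hbound : (((W.baseChange K).selmerCorank p : ℕ) : ℕ∞) ≤ 1 + 2 * heegnerModuleIndex D F :=
    hB2 W K p κ γ jbar hH D F
  -- descend to `ℚ`: quadratic base change of Selmer coranks (tree theorem)
  have hbc := selmerCorank_baseChange_quadratic_holds W K hK.1 p
  have h2 : (W.baseChange K).selmerCorank p ≤ 2 * j + 1 := nat_le_of_enat_bound hbound hidx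
  rwa [hbc] at h2

/-- The crux along this line, MODULO the four registered stubs (sorries live only in `stub_*`). -/
theorem VerticalKolyvaginBound_proof : VerticalKolyvaginBound :=
  VerticalKolyvaginBound_of stub_towerData stub_finiteLayerCriterion stub_howardHypotheses stub_howardBound

end Summit.BirchSwinnertonDyer.BirchSwinnertonDyer.Cruxes.VerticalKolyvaginBound.Birth

end
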